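/-
Origin: expansion seat `planner-pub-hodgecm-mc-sanity-1-0`, handover #3r 2026-08-18T18:55Z md5 6ed43100680402f293fe19e37d2bdf43 SUPERSEDES 95b82463fcf5 (doc-only; NEW additive leaf, 94 l.; imports HodgeCM.Model.Sanity.KernelsLoadBearing (row 5) + HodgeCM.Model.Junction.WeilThetaModelComap = mc-glue-1 RUN-32 row (src 3d4ff34ee1b6) as targeted, no rewrite; land with/after glue-1 J1 — if J1 slips hold this ONE file) (`HOME/mc/pub-hodgecm-mc-sanity-1/lean/JunctionSanity.lean`, md5 6ed43100, 94 lines);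
landed by the packager successor (mc-unitary-1-g3, gen-8 kit) in gate run 32 as `HodgeCM/Model/Sanity/JunctionSanity.lean` (verbatim).
-/
/-
HodgeCM / MODEL-CONSTRUCTION sub-cell (pub-hodgecm), node SAN — construction prover `pub-hodgecm-mc-sanity-1`
(seat planner-pub-hodgecm-mc-sanity-1-0), 2026-08-18.  Intended PKG path: `HodgeCM/Model/Sanity/JunctionSanity.lean`.
Imports `Sanity/KernelsLoadBearing.lean` (this seat, HANDOVER #3) and mc-glue-1's E-J junction J1
`Model/Junction/WeilThetaModelComap.lean` (RUN-32 row, md5 3d4ff34ee1b6); nothing restated, 0 hypotheses, 0 proof holes.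
-/
import Summits.HodgeConjecture.HodgeCM.Model.Sanity.KernelsLoadBearing
import Summits.HodgeConjecture.HodgeCM.Model.Junction.WeilThetaModelComap

/-!
# Sanity SAN-3 (J1): the junction `toLatticeModels` instantiated on the degenerate adelic model

mc-glue-1's J1 `WeilThetaModel.toLatticeModels hP V S M` turns a Weil theta model over the GENUINE adelic unitary
groups `U(V)(𝔸) ⊇ U(V)(ℚ)`, `U(W₁₂)(𝔸) ⊇ U(W₁₂)(ℚ)` into the END-STATE field `wm V c` over the lattice models
(`:= toRegime M = M.restrict (regimeSubgroup …) (regimeSubgroup …)`).  Instantiated on the universal degenerate test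
datum (`degenerateWeilThetaModel` over the adelic groups — what a producer hands outside PerL's regime, prl1-g10 J1
off-regime):

* `toLatticeModels_degenerate_θ`: J1 of the degenerate adelic model has ZERO kernels (J1 is `restrict`, it cannot
  create content) — an instance of glue-1's `toRegime_θ_mk`;
* `withAdelicDegenerateWM C` := any core with `wm V c := toLatticeModels hP V c.D (degenerate)`:
  `ZeroKernels` (`withAdelicDegenerateWM_zeroKernels`), hence the `DegenerateCores` §2 profile — C7 `Open_occ` and
  C6 `Open_thetaReal34All` hold content-free (`…_occ`, `…_thetaReal34All`) — and, over any universe with `M` and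
  HR(2,0), NOT an E2 witness (`not_allCharsNonDesign_withAdelicDegenerateWM`, from `KernelsLoadBearing`).

So the J1 slot type-checks end to end on placeholder input, and the sanity profile of the placeholder is exactly the
one the referees must reject (block R watch-list SAN-1): J1 ∘ (θ-free producer) satisfies C6/C7 vacuously and fails
the record at C5 given C2–C4.
-/

set_option autoImplicit false

noncomputable section

open HodgeCM HodgeCM.Universe HodgeCM.Adelic

attribute [-instance] Quotient.instMeasurableSpace

namespace HodgeCM

namespace WeilThetaModel

variable {L : CMField} (hP : PrintFact_unitaryCompact) {ι₁ : L →+* ℂ} (V : HermSpace3 L ι₁)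
  (S : StubTree.SeesawDatum L)

/-- The degenerate Weil theta model over the genuine adelic unitary groups of `V` and `W₁₂ = (L², diag(a₀,a₁))`. -/
abbrev adelicDegenerate : WeilThetaModel (adelicUnitaryGroup L V.Hm) (adelicUnitaryRat L V.Hm)
    (adelicUnitaryGroup L (Matrix.diagonal ![S.a 0, S.a 1])) (adelicUnitaryRat L (Matrix.diagonal ![S.a 0, S.a 1])) :=
  degenerateWeilThetaModel _ _ _ _

/-- **J1 of the degenerate adelic model has zero kernels.** -/
theorem toLatticeModels_degenerate_θ (Φ : (toLatticeModels hP V S (adelicDegenerate V S)).SK) :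
    (toLatticeModels hP V S (adelicDegenerate V S)).θ Φ = 0 := by
  ext ⟨qx, qy⟩
  induction qx using QuotientGroup.induction_on with
  | H x =>
    induction qy using QuotientGroup.induction_on with
    | H y =>
      show ((toRegime (adelicDegenerate V S)).θ Φ) (QuotientGroup.mk x, QuotientGroup.mk y) = 0
      erw [toRegime_θ_mk (adelicDegenerate V S) Φ x y, degenerateWeilThetaModel_θ]
      rfl

end WeilThetaModel

namespace Universe.AdelicThetaCore

variable {U : Universe} {hP : PrintFact_unitaryCompact} (C : U.AdelicThetaCore hP) (h : Bool)
variable (d12 d34 : ∀ {L : CMField}, SeesawCtx L → SideData L)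

/-- The core `C` with its `wm` slot filled through J1 by the degenerate ADELIC model. -/
def withAdelicDegenerateWM : U.AdelicThetaCore hP :=
  ⟨C.emb, C.cover, fun V c => WeilThetaModel.toLatticeModels hP V c.D (WeilThetaModel.adelicDegenerate V c.D), C.Theta⟩

/-- (Ported verbatim from the HodgeCMPerL package; no docstring in the source.) -/
theorem withAdelicDegenerateWM_zeroKernels : C.withAdelicDegenerateWM.ZeroKernels :=
  fun V c Φ => WeilThetaModel.toLatticeModels_degenerate_θ hP V c.D Φ

/-- C7 `Open_occ` holds content-free. -/
theorem withAdelicDegenerateWM_occ : (C.withAdelicDegenerateWM.thetaModel h d12 d34).Open_occ :=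
  open_occ_of_zeroKernels h d12 d34 C.withAdelicDegenerateWM_zeroKernels

/-- C6 `Open_thetaReal34All` holds content-free. -/
theorem withAdelicDegenerateWM_thetaReal34All : (C.withAdelicDegenerateWM.thetaModel h d12 d34).Open_thetaReal34All :=
  open_thetaReal34All_of_zeroKernels h d12 d34 C.withAdelicDegenerateWM_zeroKernels

/-- … and over any universe with the model facts and HR(2,0) it is NOT an E2 witness. -/
theorem not_allCharsNonDesign_withAdelicDegenerateWM (M : U.ModelAxioms) (hHR : U.Fact_hodgeRiemann20) :
    ¬ (C.withAdelicDegenerateWM.thetaModel h d12 d34).AllCharsNonDesign :=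
  not_allCharsNonDesign_of_zeroKernels h d12 d34 M hHR C.withAdelicDegenerateWM_zeroKernels

end Universe.AdelicThetaCore

end HodgeCM

end
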